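import Mathlib
import Summits.NavierStokesRegularity.NavierStokesRegularity.Theorems.FilamentSkeletonRssAreaLawSlavingKernel

/-!
# Area-law slaving, complex part 1 — HOLOMORPHIC regular solution at a regular singular point
# (`FilamentSkeletonRss`, child crux `TangentSkeletonNearStraight`, stmt-NavierStokesRegularity-28295, line
# `child_tangent_analytic_strip`, ∃-side of the registered stub `stub_analyticClosing`: the `StadiumAnalyticArea` conjunct)

The output `TangentSkeletonAnalytic` of the line asks, besides the real area law `w·Aa′ = (3/2 − w′)·Aa + 4` (slaved to
the slip by `Theorems.AreaLawSlaving.*`, parts 1–10), for `StadiumAnalyticArea`: an ANALYTIC CONTINUATION of each core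
area to the stadium around the ball segment.  Since the slip `w = ⟪v∘X, X′⟫` is stadium-analytic along the scheme
(`StripPropagation`), the continuation of `Aa` is the regular solution of the SAME singular ODE read over `ℂ`: the zero `c`
of `w` is a regular singular point with exponent `−ν`, `ν = (w′(c) − 3/2)·(…) > 0`, and the Frobenius formula of the real
part 1 (`Theorems.AreaLawSlaving.singular_regular_solution`),
  `A = e^{P}·J`,  `P′ = ã`,  `z·ã(z) = a(z) + ν` (Hadamard quotient `ã(z) = ∫₀¹ a′(tz) dt`),
  `J(z) = ∫₀¹ t^{ν−1} φ(tz) dt`,  `φ = b·e^{−P}`,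
makes sense verbatim on any open set `U ∋ 0` that is STAR-SHAPED with respect to the singular point (a stadium is convex)
and defines a holomorphic function there.  This file proves exactly that:

* `hasDerivAt_integral_weight_comp_mul` — the engine: for `g` holomorphic on `U` and an integrable weight `w` on `[0,1]`,
  `z ↦ ∫₀¹ w(t)·g(tz) dt` is complex-differentiable on `U` with derivative `∫₀¹ w(t)·g′(tz)·t dt` (differentiation under
  the integral sign, dominated on a compact thickening of the segment `[0,1]·z₀ ⊂ U`);
* `mul_integral_deriv_comp_mul` — Hadamard over `ℂ`: `z·∫₀¹ g′(tz) dt = g(z) − g(0)`;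
* `integral_add_mul_deriv_eq` — `∫₀¹ (h(tz) + t z h′(tz)) dt = h(z)` (so `P(z) = z ∫₀¹ ã(tz) dt` has `P′ = ã`);
* `euler_identity` — `z·∫₀¹ t^{ν−1} φ′(tz) t dt = φ(z) − ν ∫₀¹ t^{ν−1} φ(tz) dt`, and `eulerIntegral_zero`;
* `singular_regular_solution_holo` — for `a, b` holomorphic on `U`, `a(0) = −ν < 0`: a function `A` HOLOMORPHIC ON `U` with
  `z·A′(z) = a(z)A(z) + b(z)` on `U` and `A(0) = b(0)/ν`.

Left for the `StadiumAnalyticArea` conjunct (census): identification of the real trace with the real slaved area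
(uniqueness, `Theorems.AreaLawSlaving` part 6) and the factor-two window `Aa/2 ≤ Re G ≤ |G| ≤ 2Aa` on a thin enough stadium
(log-derivative bound of `A` at the waist scale).

HONEST FRAMING: classical complex analysis (Frobenius at a regular singular point, [Coddington–Levinson 1955, Ch. 4 §1];
[Ince, Ordinary Differential Equations, §15.3]; folklore) serving a HYPOTHETICAL filament skeleton on the NEGATIVE side of a
MODEL route; no registered stub is closed by this file and nothing here bears on Navier–Stokes regularity or blow-up.
`--supports stmt-NavierStokesRegularity-28295`.
-/

set_option linter.dupNamespace false

noncomputable section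

namespace Summit.NavierStokesRegularity.NavierStokesRegularity.Theorems.AreaLawSlavingHolo

open Set MeasureTheory Metric Filter
open Summit.NavierStokesRegularity.NavierStokesRegularity.Theorems.AreaLawSlaving (mem_uIoc_zero_one)
open scoped Topology Interval

/-! ## §1 Star-shaped bookkeeping -/

/-- In a set star-shaped with respect to `0`, the segment `[0,1]·z₀` is a compact subset. [folklore] -/
theorem isCompact_segment_image (z₀ : ℂ) : IsCompact ((fun t : ℝ => (t : ℂ) * z₀) '' Icc (0:ℝ) 1) :=
  isCompact_Icc.image (Complex.continuous_ofReal.mul continuous_const)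

/-- A compact thickening of the segment `[0,1]·z₀` inside the open star-shaped set `U`, which contains every `t·x` with
`t ∈ [0,1]` and `x` in the corresponding ball around `z₀`. [folklore] -/
theorem exists_thickening {U : Set ℂ} (hU : IsOpen U)
    (hstar : ∀ z ∈ U, ∀ t : ℝ, t ∈ Icc (0:ℝ) 1 → (t : ℂ) * z ∈ U) {z₀ : ℂ} (hz₀ : z₀ ∈ U) :
    ∃ δ : ℝ, 0 < δ ∧ ∃ K : Set ℂ, IsCompact K ∧ K ⊆ U ∧
      ∀ x ∈ ball z₀ δ, ∀ t : ℝ, t ∈ Icc (0:ℝ) 1 → (t : ℂ) * x ∈ K := by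
  set S := (fun t : ℝ => (t : ℂ) * z₀) '' Icc (0:ℝ) 1 with hS
  have hSc : IsCompact S := isCompact_segment_image z₀
  have hSU : S ⊆ U := by
    rintro _ ⟨t, ht, rfl⟩
    exact hstar z₀ hz₀ t ht
  obtain ⟨δ, hδ, hδU⟩ := hSc.exists_cthickening_subset_open hU hSU
  refine ⟨δ, hδ, cthickening δ S, hSc.cthickening, hδU, fun x hx t ht => ?_⟩
  refine Metric.mem_cthickening_of_dist_le ((t : ℂ) * x) ((t : ℂ) * z₀) δ S ⟨t, ht, rfl⟩ ?_
  rw [dist_eq_norm, ← mul_sub, norm_mul, Complex.norm_real, Real.norm_eq_abs, abs_of_nonneg ht.1]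
  have hx' : ‖x - z₀‖ < δ := by rwa [mem_ball, dist_eq_norm] at hx
  calc t * ‖x - z₀‖ ≤ 1 * ‖x - z₀‖ := mul_le_mul_of_nonneg_right ht.2 (norm_nonneg _)
    _ ≤ δ := by rw [one_mul]; exact hx'.le

/-- `t ↦ g(t·x)` is continuous on `[0,1]` when `g` is continuous on `U ∋ t·x`. [folklore] -/
theorem continuousOn_comp_mul {U : Set ℂ} {g : ℂ → ℂ} (hg : ContinuousOn g U) {x : ℂ}
    (hx : ∀ t : ℝ, t ∈ Icc (0:ℝ) 1 → (t : ℂ) * x ∈ U) :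
    ContinuousOn (fun t : ℝ => g ((t : ℂ) * x)) (Icc (0:ℝ) 1) :=
  hg.comp (Complex.continuous_ofReal.mul continuous_const).continuousOn fun t ht => hx t ht

/-! ## §2 The engine: differentiation under the integral sign along rays -/

/-- **Holomorphy of weighted ray integrals.**  `U` open and star-shaped w.r.t. `0`, `g` holomorphic on `U`, `w` an
integrable real weight on `[0,1]`.  Then `z ↦ ∫₀¹ w(t)·g(tz) dt` has the complex derivative `∫₀¹ w(t)·(g′(tz)·t) dt` at
every `z₀ ∈ U`. [folklore] -/
theorem hasDerivAt_integral_weight_comp_mul {U : Set ℂ} (hU : IsOpen U)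
    (hstar : ∀ z ∈ U, ∀ t : ℝ, t ∈ Icc (0:ℝ) 1 → (t : ℂ) * z ∈ U) {g : ℂ → ℂ} (hg : DifferentiableOn ℂ g U)
    {w : ℝ → ℝ} (hw : IntervalIntegrable w volume 0 1) {z₀ : ℂ} (hz₀ : z₀ ∈ U) :
    HasDerivAt (fun z => ∫ t in (0:ℝ)..1, (w t : ℂ) * g ((t : ℂ) * z))
      (∫ t in (0:ℝ)..1, (w t : ℂ) * (deriv g ((t : ℂ) * z₀) * t)) z₀ := by
  obtain ⟨δ, hδ, K, hK, hKU, hmem⟩ := exists_thickening hU hstar hz₀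
  have hgan : AnalyticOnNhd ℂ g U := hg.analyticOnNhd hU
  have hgc : ContinuousOn g U := hg.continuousOn
  have hg'c : ContinuousOn (deriv g) U := hgan.deriv.continuousOn
  obtain ⟨M, hM⟩ := hK.exists_bound_of_continuousOn (hg'c.mono hKU)
  have hM0 : 0 ≤ M := le_trans (norm_nonneg _) (hM _ (hmem z₀ (mem_ball_self hδ) 0 ⟨le_rfl, zero_le_one⟩))
  -- measurability of the weight on `Ι 0 1`
  have hwm : AEStronglyMeasurable (fun t => (w t : ℂ)) (volume.restrict (Ι (0:ℝ) 1)) := by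
    have h1 : AEStronglyMeasurable w (volume.restrict (Ι (0:ℝ) 1)) := (hw.def').aestronglyMeasurable
    exact Complex.continuous_ofReal.comp_aestronglyMeasurable h1
  have hwi : IntervalIntegrable (fun t => (w t : ℂ)) volume 0 1 :=
    intervalIntegrable_iff.2 ((intervalIntegrable_iff.1 hw).ofReal)
  have hIcc : Ι (0:ℝ) 1 ⊆ Icc (0:ℝ) 1 := fun t ht => ⟨(mem_uIoc_zero_one ht).1.le, (mem_uIoc_zero_one ht).2⟩
  have huIcc : uIcc (0:ℝ) 1 = Icc 0 1 := uIcc_of_le zero_le_one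
  have key := intervalIntegral.hasDerivAt_integral_of_dominated_loc_of_deriv_le
    (μ := volume) (a := (0:ℝ)) (b := 1) (s := ball z₀ δ)
    (F := fun x t => (w t : ℂ) * g ((t : ℂ) * x))
    (F' := fun x t => (w t : ℂ) * (deriv g ((t : ℂ) * x) * t))
    (x₀ := z₀) (bound := fun t => |w t| * M) (ball_mem_nhds z₀ hδ) ?_ ?_ ?_ ?_ ?_ ?_
  · exact key.2
  · filter_upwards [ball_mem_nhds z₀ hδ] with x hx
    refine hwm.mul (ContinuousOn.aestronglyMeasurable ?_ measurableSet_uIoc)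
    exact (continuousOn_comp_mul hgc (fun t ht => hKU (hmem x hx t ht))).mono hIcc
  · refine hwi.mul_continuousOn ?_
    rw [huIcc]
    exact continuousOn_comp_mul hgc (fun t ht => hKU (hmem z₀ (mem_ball_self hδ) t ht))
  · refine hwm.mul (ContinuousOn.aestronglyMeasurable ?_ measurableSet_uIoc)
    refine ContinuousOn.mono ?_ hIcc
    exact (continuousOn_comp_mul hg'c (fun t ht => hKU (hmem z₀ (mem_ball_self hδ) t ht))).mul
      Complex.continuous_ofReal.continuousOn
  · refine Eventually.of_forall fun t ht x hx => ?_
    obtain ⟨ht0, ht1⟩ := mem_uIoc_zero_one ht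
    have hb := hM _ (hmem x hx t ⟨ht0.le, ht1⟩)
    rw [norm_mul, norm_mul, Complex.norm_real, Real.norm_eq_abs, Complex.norm_real, Real.norm_eq_abs,
      abs_of_pos ht0]
    calc |w t| * (‖deriv g ((t : ℂ) * x)‖ * t) ≤ |w t| * (M * 1) :=
          mul_le_mul_of_nonneg_left (mul_le_mul hb ht1 ht0.le hM0) (abs_nonneg _)
      _ = |w t| * M := by rw [mul_one]
  · exact hw.norm.mul_const M
  · refine Eventually.of_forall fun t _ x hx => ?_
    have hxU : (t : ℂ) * x ∈ U := hKU (hmem x hx t ?_)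
    swap
    · exact ⟨(mem_uIoc_zero_one ‹_›).1.le, (mem_uIoc_zero_one ‹_›).2⟩
    have h1 : HasDerivAt g (deriv g ((t : ℂ) * x)) ((t : ℂ) * x) :=
      (hg.differentiableAt (hU.mem_nhds hxU)).hasDerivAt
    have h2 : HasDerivAt (fun x : ℂ => (t : ℂ) * x) (t : ℂ) x := by
      simpa using (hasDerivAt_id x).const_mul (t : ℂ)
    have h3 := h1.comp x h2
    exact h3.const_mul _


/-- Differentiability of a weighted ray integral on the whole star-shaped set (corollary of the engine). [folklore] -/
theorem differentiableOn_integral_weight_comp_mul {U : Set ℂ} (hU : IsOpen U)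
    (hstar : ∀ z ∈ U, ∀ t : ℝ, t ∈ Icc (0:ℝ) 1 → (t : ℂ) * z ∈ U) {g : ℂ → ℂ} (hg : DifferentiableOn ℂ g U)
    {w : ℝ → ℝ} (hw : IntervalIntegrable w volume 0 1) :
    DifferentiableOn ℂ (fun z => ∫ t in (0:ℝ)..1, (w t : ℂ) * g ((t : ℂ) * z)) U := fun _ hz =>
  (hasDerivAt_integral_weight_comp_mul hU hstar hg hw hz).differentiableAt.differentiableWithinAt

/-! ## §3 Hadamard's lemma and the ray primitive over `ℂ` -/

/-- Chain rule along a ray: `t ↦ g(t·z)` has real-parameter derivative `g′(tz)·z` when `t·z ∈ U`. [folklore] -/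
theorem hasDerivAt_comp_ray {U : Set ℂ} (hU : IsOpen U) {g : ℂ → ℂ} (hg : DifferentiableOn ℂ g U) (z : ℂ)
    {t : ℝ} (ht : (t : ℂ) * z ∈ U) :
    HasDerivAt (fun s : ℝ => g ((s : ℂ) * z)) (deriv g ((t : ℂ) * z) * z) t := by
  have h1 : HasDerivAt g (deriv g ((t : ℂ) * z)) ((t : ℂ) * z) :=
    (hg.differentiableAt (hU.mem_nhds ht)).hasDerivAt
  have h2 : HasDerivAt (fun u : ℂ => u * z) z (t : ℂ) := by
    simpa using (hasDerivAt_id (t : ℂ)).mul_const z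
  have h3 : HasDerivAt (fun u : ℂ => g (u * z)) (deriv g ((t : ℂ) * z) * z) (t : ℂ) := h1.comp (t : ℂ) h2
  exact h3.comp_ofReal

/-- **Hadamard's lemma over `ℂ`, integral form.**  For `g` holomorphic on the open star-shaped `U` and `z ∈ U`:
`z · ∫₀¹ g′(tz) dt = g(z) − g(0)`. [folklore] -/
theorem mul_integral_deriv_comp_mul {U : Set ℂ} (hU : IsOpen U)
    (hstar : ∀ z ∈ U, ∀ t : ℝ, t ∈ Icc (0:ℝ) 1 → (t : ℂ) * z ∈ U) {g : ℂ → ℂ} (hg : DifferentiableOn ℂ g U)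
    {z : ℂ} (hz : z ∈ U) :
    z * ∫ t in (0:ℝ)..1, deriv g ((t : ℂ) * z) = g z - g 0 := by
  have hg'c : ContinuousOn (deriv g) U := (hg.analyticOnNhd hU).deriv.continuousOn
  have hderiv : ∀ t ∈ Ioo (0:ℝ) 1, HasDerivAt (fun s : ℝ => g ((s : ℂ) * z)) (deriv g ((t : ℂ) * z) * z) t :=
    fun t ht => hasDerivAt_comp_ray hU hg z (hstar z hz t ⟨ht.1.le, ht.2.le⟩)
  have hcont : ContinuousOn (fun s : ℝ => g ((s : ℂ) * z)) (Icc (0:ℝ) 1) :=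
    continuousOn_comp_mul hg.continuousOn (fun t ht => hstar z hz t ht)
  have hint : IntervalIntegrable (fun t : ℝ => deriv g ((t : ℂ) * z) * z) volume 0 1 := by
    refine ContinuousOn.intervalIntegrable ?_
    rw [uIcc_of_le zero_le_one]
    exact (continuousOn_comp_mul hg'c (fun t ht => hstar z hz t ht)).mul continuousOn_const
  have hftc := intervalIntegral.integral_eq_sub_of_hasDerivAt_of_le zero_le_one hcont hderiv hint
  simp only [Complex.ofReal_one, one_mul, Complex.ofReal_zero, zero_mul] at hftc
  rw [← hftc, intervalIntegral.integral_mul_const, mul_comm]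

/-- **Ray primitive.**  For `h` holomorphic on the open star-shaped `U` and `z ∈ U`:
`∫₀¹ (h(tz) + t·z·h′(tz)) dt = h(z)` (fundamental theorem of calculus for `t ↦ t·h(tz)`); consequently
`P(z) = z·∫₀¹ h(tz) dt` satisfies `P′ = h`. [folklore] -/
theorem integral_add_mul_deriv_eq {U : Set ℂ} (hU : IsOpen U)
    (hstar : ∀ z ∈ U, ∀ t : ℝ, t ∈ Icc (0:ℝ) 1 → (t : ℂ) * z ∈ U) {h : ℂ → ℂ} (hh : DifferentiableOn ℂ h U)
    {z : ℂ} (hz : z ∈ U) :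
    ∫ t in (0:ℝ)..1, (h ((t : ℂ) * z) + (t : ℂ) * z * deriv h ((t : ℂ) * z)) = h z := by
  have hh'c : ContinuousOn (deriv h) U := (hh.analyticOnNhd hU).deriv.continuousOn
  have hderiv : ∀ t ∈ Ioo (0:ℝ) 1, HasDerivAt (fun s : ℝ => (s : ℂ) * h ((s : ℂ) * z))
      (h ((t : ℂ) * z) + (t : ℂ) * z * deriv h ((t : ℂ) * z)) t := by
    intro t ht
    have h1 := hasDerivAt_comp_ray hU hh z (hstar z hz t ⟨ht.1.le, ht.2.le⟩)
    have h2 : HasDerivAt (fun s : ℝ => (s : ℂ)) 1 t := Complex.ofRealCLM.hasDerivAt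
    have h3 := h2.mul h1
    refine h3.congr_deriv ?_
    ring
  have hcont : ContinuousOn (fun s : ℝ => (s : ℂ) * h ((s : ℂ) * z)) (Icc (0:ℝ) 1) :=
    Complex.continuous_ofReal.continuousOn.mul (continuousOn_comp_mul hh.continuousOn (fun t ht => hstar z hz t ht))
  have hint : IntervalIntegrable (fun t : ℝ => h ((t : ℂ) * z) + (t : ℂ) * z * deriv h ((t : ℂ) * z)) volume 0 1 := by
    refine ContinuousOn.intervalIntegrable ?_
    rw [uIcc_of_le zero_le_one]
    exact (continuousOn_comp_mul hh.continuousOn (fun t ht => hstar z hz t ht)).add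
      ((Complex.continuous_ofReal.continuousOn.mul continuousOn_const).mul
        (continuousOn_comp_mul hh'c (fun t ht => hstar z hz t ht)))
  have hftc := intervalIntegral.integral_eq_sub_of_hasDerivAt_of_le zero_le_one hcont hderiv hint
  simp only [Complex.ofReal_one, one_mul, Complex.ofReal_zero, zero_mul, sub_zero] at hftc
  exact hftc

/-- **The ray primitive is a primitive.**  For `h` holomorphic on the open star-shaped `U`, the function
`P(z) = z · ∫₀¹ h(tz) dt` has complex derivative `h(z₀)` at every `z₀ ∈ U`. [folklore] -/
theorem hasDerivAt_ray_primitive {U : Set ℂ} (hU : IsOpen U)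
    (hstar : ∀ z ∈ U, ∀ t : ℝ, t ∈ Icc (0:ℝ) 1 → (t : ℂ) * z ∈ U) {h : ℂ → ℂ} (hh : DifferentiableOn ℂ h U)
    {z₀ : ℂ} (hz₀ : z₀ ∈ U) :
    HasDerivAt (fun z => z * ∫ t in (0:ℝ)..1, h ((t : ℂ) * z)) (h z₀) z₀ := by
  have hw : IntervalIntegrable (fun _ : ℝ => (1:ℝ)) volume 0 1 := intervalIntegrable_const
  have hI := hasDerivAt_integral_weight_comp_mul hU hstar hh hw hz₀
  simp only [Complex.ofReal_one, one_mul] at hI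
  have hP := (hasDerivAt_id z₀).mul hI
  simp only [id, one_mul] at hP
  refine hP.congr_deriv ?_
  rw [← integral_add_mul_deriv_eq hU hstar hh hz₀]
  have hh'c : ContinuousOn (deriv h) U := (hh.analyticOnNhd hU).deriv.continuousOn
  have hi1 : IntervalIntegrable (fun t : ℝ => h ((t : ℂ) * z₀)) volume 0 1 := by
    refine ContinuousOn.intervalIntegrable ?_
    rw [uIcc_of_le zero_le_one]
    exact continuousOn_comp_mul hh.continuousOn (fun t ht => hstar z₀ hz₀ t ht)
  have hi2 : IntervalIntegrable (fun t : ℝ => deriv h ((t : ℂ) * z₀) * t) volume 0 1 := by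
    refine ContinuousOn.intervalIntegrable ?_
    rw [uIcc_of_le zero_le_one]
    exact (continuousOn_comp_mul hh'c (fun t ht => hstar z₀ hz₀ t ht)).mul Complex.continuous_ofReal.continuousOn
  rw [← intervalIntegral.integral_const_mul, ← intervalIntegral.integral_add hi1 (hi2.const_mul z₀)]
  refine intervalIntegral.integral_congr fun t _ => ?_
  show h ((t : ℂ) * z₀) + z₀ * (deriv h ((t : ℂ) * z₀) * t) = h ((t : ℂ) * z₀) + (t : ℂ) * z₀ * deriv h ((t : ℂ) * z₀)
  ring

/-! ## §4 The Euler transform `J(z) = ∫₀¹ t^{ν−1} φ(tz) dt` over `ℂ` -/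

/-- **Euler identity over `ℂ`.**  For `φ` holomorphic on the open star-shaped `U`, `ν > 0`, `z ∈ U`:
`z · ∫₀¹ t^{ν−1}(φ′(tz)·t) dt = φ(z) − ν · ∫₀¹ t^{ν−1} φ(tz) dt` (FTC for `t ↦ t^ν φ(tz)` on `[0,1]`). [folklore] -/
theorem euler_identity {U : Set ℂ} (hU : IsOpen U)
    (hstar : ∀ z ∈ U, ∀ t : ℝ, t ∈ Icc (0:ℝ) 1 → (t : ℂ) * z ∈ U) {ν : ℝ} (hν : 0 < ν) {φ : ℂ → ℂ}
    (hφ : DifferentiableOn ℂ φ U) {z : ℂ} (hz : z ∈ U) :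
    z * (∫ t in (0:ℝ)..1, ((t ^ (ν - 1) : ℝ) : ℂ) * (deriv φ ((t : ℂ) * z) * t)) =
      φ z - ν * ∫ t in (0:ℝ)..1, ((t ^ (ν - 1) : ℝ) : ℂ) * φ ((t : ℂ) * z) := by
  have hφ'c : ContinuousOn (deriv φ) U := (hφ.analyticOnNhd hU).deriv.continuousOn
  have hφz : ContinuousOn (fun s : ℝ => φ ((s : ℂ) * z)) (Icc (0:ℝ) 1) :=
    continuousOn_comp_mul hφ.continuousOn (fun t ht => hstar z hz t ht)
  have hφ'z : ContinuousOn (fun s : ℝ => deriv φ ((s : ℂ) * z)) (Icc (0:ℝ) 1) :=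
    continuousOn_comp_mul hφ'c (fun t ht => hstar z hz t ht)
  -- derivative of `t ↦ t^ν φ(tz)` on `(0,1)`
  have hG : ∀ t ∈ Ioo (0:ℝ) 1, HasDerivAt (fun s : ℝ => ((s ^ ν : ℝ) : ℂ) * φ ((s : ℂ) * z))
      (((ν * t ^ (ν - 1) : ℝ) : ℂ) * φ ((t : ℂ) * z) + ((t ^ ν : ℝ) : ℂ) * (deriv φ ((t : ℂ) * z) * z)) t := by
    intro t ht
    have h1 : HasDerivAt (fun s : ℝ => s ^ ν) (ν * t ^ (ν - 1)) t :=
      Real.hasDerivAt_rpow_const (Or.inl ht.1.ne')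
    have h1c : HasDerivAt (fun s : ℝ => ((s ^ ν : ℝ) : ℂ)) (((ν * t ^ (ν - 1) : ℝ) : ℂ)) t :=
      (Complex.ofRealCLM.hasFDerivAt.comp_hasDerivAt t h1).congr_deriv (by simp)
    have h2 := hasDerivAt_comp_ray hU hφ z (hstar z hz t ⟨ht.1.le, ht.2.le⟩)
    exact h1c.mul h2
  have hcont : ContinuousOn (fun s : ℝ => ((s ^ ν : ℝ) : ℂ) * φ ((s : ℂ) * z)) (Icc (0:ℝ) 1) :=
    (Complex.continuous_ofReal.comp (Real.continuous_rpow_const hν.le)).continuousOn.mul hφz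
  have hint1 : IntervalIntegrable (fun t : ℝ => ((ν * t ^ (ν - 1) : ℝ) : ℂ) * φ ((t : ℂ) * z)) volume 0 1 := by
    have h1 : IntervalIntegrable (fun t : ℝ => ν * t ^ (ν - 1)) volume 0 1 :=
      (intervalIntegral.intervalIntegrable_rpow' (by linarith)).const_mul ν
    have h2 : IntervalIntegrable (fun t : ℝ => ((ν * t ^ (ν - 1) : ℝ) : ℂ)) volume 0 1 :=
      intervalIntegrable_iff.2 ((intervalIntegrable_iff.1 h1).ofReal)
    refine h2.mul_continuousOn ?_
    rw [uIcc_of_le zero_le_one]; exact hφz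
  have hint2 : IntervalIntegrable (fun t : ℝ => ((t ^ ν : ℝ) : ℂ) * (deriv φ ((t : ℂ) * z) * z)) volume 0 1 := by
    refine ContinuousOn.intervalIntegrable ?_
    rw [uIcc_of_le zero_le_one]
    exact (Complex.continuous_ofReal.comp (Real.continuous_rpow_const hν.le)).continuousOn.mul
      (hφ'z.mul continuousOn_const)
  have hftc := intervalIntegral.integral_eq_sub_of_hasDerivAt_of_le zero_le_one hcont hG (hint1.add hint2)
  rw [intervalIntegral.integral_add hint1 hint2] at hftc
  simp only [Real.one_rpow, Complex.ofReal_one, one_mul, Real.zero_rpow hν.ne', Complex.ofReal_zero, zero_mul,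
    sub_zero] at hftc
  -- identify the two integrals
  have e1 : ∫ t in (0:ℝ)..1, ((ν * t ^ (ν - 1) : ℝ) : ℂ) * φ ((t : ℂ) * z) =
      ν * ∫ t in (0:ℝ)..1, ((t ^ (ν - 1) : ℝ) : ℂ) * φ ((t : ℂ) * z) := by
    rw [← intervalIntegral.integral_const_mul]
    refine intervalIntegral.integral_congr fun t _ => ?_
    show ((ν * t ^ (ν - 1) : ℝ) : ℂ) * φ ((t : ℂ) * z) = (ν : ℂ) * (((t ^ (ν - 1) : ℝ) : ℂ) * φ ((t : ℂ) * z))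
    push_cast; ring
  have e2 : ∫ t in (0:ℝ)..1, ((t ^ ν : ℝ) : ℂ) * (deriv φ ((t : ℂ) * z) * z) =
      z * ∫ t in (0:ℝ)..1, ((t ^ (ν - 1) : ℝ) : ℂ) * (deriv φ ((t : ℂ) * z) * t) := by
    rw [← intervalIntegral.integral_const_mul]
    refine intervalIntegral.integral_congr fun t ht => ?_
    rw [uIcc_of_le zero_le_one] at ht
    show ((t ^ ν : ℝ) : ℂ) * (deriv φ ((t : ℂ) * z) * z) = z * (((t ^ (ν - 1) : ℝ) : ℂ) * (deriv φ ((t : ℂ) * z) * t))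
    rcases ht.1.eq_or_lt with h | h
    · rw [← h]; simp [Real.zero_rpow hν.ne']
    · have : (t ^ ν : ℝ) = t ^ (ν - 1) * t := by
        rw [Real.rpow_sub_one h.ne']; field_simp
      rw [this]; push_cast; ring
  rw [e1, e2] at hftc
  -- hftc : ν * J + z * J' = φ z
  have := hftc
  linear_combination this

/-- Value of the complex Euler transform at `0`: `∫₀¹ t^{ν−1} φ(0) dt = φ(0)/ν`. [folklore] -/
theorem eulerIntegral_zero {ν : ℝ} (hν : 0 < ν) (φ : ℂ → ℂ) :
    ∫ t in (0:ℝ)..1, ((t ^ (ν - 1) : ℝ) : ℂ) * φ ((t : ℂ) * 0) = φ 0 / ν := by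
  simp only [mul_zero]
  rw [intervalIntegral.integral_mul_const]
  have h : ∫ t in (0:ℝ)..1, ((t ^ (ν - 1) : ℝ) : ℂ) = ((∫ t in (0:ℝ)..1, t ^ (ν - 1) : ℝ) : ℂ) :=
    intervalIntegral.integral_ofReal
  rw [h, integral_rpow (Or.inl (by linarith))]
  simp only [sub_add_cancel, Real.one_rpow, Real.zero_rpow hν.ne', sub_zero]
  have hν' : (ν : ℂ) ≠ 0 := by exact_mod_cast hν.ne'
  push_cast
  field_simp

/-! ## §5 The holomorphic regular solution at a regular singular point -/

/-- **Holomorphic regular solution (Frobenius, exponent `−ν < 0`).**  Let `U ⊆ ℂ` be open and star-shaped with respect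
to `0` (so `0 ∈ U` once `U` is inhabited); `a, b` holomorphic on `U` with `a(0) = −ν`, `ν > 0`.  Then the singular linear equation `z·A′(z) = a(z)·A(z) + b(z)`
has a solution `A` HOLOMORPHIC ON `U` (in particular at the singular point) with `A(0) = b(0)/ν`, namely
`A = e^{P}·J`, `P(z) = z∫₀¹ ã(tz) dt`, `ã(z) = ∫₀¹ a′(tz) dt`, `J(z) = ∫₀¹ t^{ν−1}(b e^{−P})(tz) dt`.
[Coddington–Levinson 1955, Ch. 4 §1; folklore] -/
theorem singular_regular_solution_holo {U : Set ℂ} (hU : IsOpen U)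
    (hstar : ∀ z ∈ U, ∀ t : ℝ, t ∈ Icc (0:ℝ) 1 → (t : ℂ) * z ∈ U) {ν : ℝ} (hν : 0 < ν)
    {a b : ℂ → ℂ} (ha : DifferentiableOn ℂ a U) (hb : DifferentiableOn ℂ b U) (ha0 : a 0 = -ν) :
    ∃ A : ℂ → ℂ, DifferentiableOn ℂ A U ∧ (∀ z ∈ U, z * deriv A z = a z * A z + b z) ∧ A 0 = b 0 / ν := by
  have hw1 : IntervalIntegrable (fun _ : ℝ => (1:ℝ)) volume 0 1 := intervalIntegrable_const
  -- the Hadamard quotient `ah` of `a` at `0`: `z * ah z = a z + ν`, holomorphic on `U`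
  obtain ⟨ah, hah⟩ : ∃ ah : ℂ → ℂ, ah = fun z => ∫ t in (0:ℝ)..1, deriv a ((t : ℂ) * z) := ⟨_, rfl⟩
  have ha' : DifferentiableOn ℂ (deriv a) U := (ha.analyticOnNhd hU).deriv.differentiableOn
  have hah_d : DifferentiableOn ℂ ah U := by
    have := differentiableOn_integral_weight_comp_mul hU hstar ha' hw1
    simp only [Complex.ofReal_one, one_mul] at this
    rw [hah]; exact this
  have hah_mul : ∀ z ∈ U, z * ah z = a z + ν := by
    intro z hz; rw [hah]; simp only; rw [mul_integral_deriv_comp_mul hU hstar ha hz, ha0]; ring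
  -- its ray primitive `P`, `P′ = ah`, `P 0 = 0`
  obtain ⟨P, hP⟩ : ∃ P : ℂ → ℂ, P = fun z => z * ∫ t in (0:ℝ)..1, ah ((t : ℂ) * z) := ⟨_, rfl⟩
  have hPd : ∀ z ∈ U, HasDerivAt P (ah z) z := by
    intro z hz; rw [hP]; exact hasDerivAt_ray_primitive hU hstar hah_d hz
  have hP0 : P 0 = 0 := by rw [hP]; simp
  have hPD : DifferentiableOn ℂ P U := fun z hz => (hPd z hz).differentiableAt.differentiableWithinAt
  -- `φ = b e^{-P}`
  obtain ⟨φ, hφ⟩ : ∃ φ : ℂ → ℂ, φ = fun z => b z * Complex.exp (-P z) := ⟨_, rfl⟩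
  have hφD : DifferentiableOn ℂ φ U := by
    rw [hφ]; exact hb.mul (hPD.neg.cexp)
  have hEφ : ∀ z, Complex.exp (P z) * φ z = b z := by
    intro z; rw [hφ]; simp only
    rw [Complex.exp_neg, mul_comm (b z), ← mul_assoc, mul_inv_cancel₀ (Complex.exp_ne_zero _), one_mul]
  -- the Euler transform `J` of `φ` and its derivative `J'`
  have hwν : IntervalIntegrable (fun t : ℝ => t ^ (ν - 1)) volume 0 1 :=
    intervalIntegral.intervalIntegrable_rpow' (by linarith)
  obtain ⟨J, hJ⟩ : ∃ J : ℂ → ℂ, J = fun z => ∫ t in (0:ℝ)..1, ((t ^ (ν - 1) : ℝ) : ℂ) * φ ((t : ℂ) * z) := ⟨_, rfl⟩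
  obtain ⟨J', hJ'⟩ : ∃ J' : ℂ → ℂ,
      J' = fun z => ∫ t in (0:ℝ)..1, ((t ^ (ν - 1) : ℝ) : ℂ) * (deriv φ ((t : ℂ) * z) * t) := ⟨_, rfl⟩
  have hJd : ∀ z ∈ U, HasDerivAt J (J' z) z := by
    intro z hz; rw [hJ, hJ']; exact hasDerivAt_integral_weight_comp_mul hU hstar hφD hwν hz
  have hJeuler : ∀ z ∈ U, z * J' z = φ z - ν * J z := by
    intro z hz; rw [hJ, hJ']; exact euler_identity hU hstar hν hφD hz
  have hJ0 : J 0 = φ 0 / ν := by rw [hJ]; exact eulerIntegral_zero hν φ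
  -- `A = e^P J`
  have hA : ∀ z ∈ U, HasDerivAt (fun z => Complex.exp (P z) * J z)
      (Complex.exp (P z) * ah z * J z + Complex.exp (P z) * J' z) z :=
    fun z hz => ((hPd z hz).cexp).mul (hJd z hz)
  refine ⟨fun z => Complex.exp (P z) * J z, fun z hz => (hA z hz).differentiableAt.differentiableWithinAt,
    fun z hz => ?_, ?_⟩
  · rw [(hA z hz).deriv]
    calc z * (Complex.exp (P z) * ah z * J z + Complex.exp (P z) * J' z)
        = Complex.exp (P z) * ((z * ah z) * J z + z * J' z) := by ring
      _ = Complex.exp (P z) * ((a z + ν) * J z + (φ z - ν * J z)) := by rw [hah_mul z hz, hJeuler z hz]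
      _ = a z * (Complex.exp (P z) * J z) + Complex.exp (P z) * φ z := by ring
      _ = a z * (Complex.exp (P z) * J z) + b z := by rw [hEφ]
  · simp only [hP0, Complex.exp_zero, one_mul, hJ0]
    have : φ 0 = b 0 := by rw [hφ]; simp [hP0]
    rw [this]

end Summit.NavierStokesRegularity.NavierStokesRegularity.Theorems.AreaLawSlavingHolo
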